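import Summits.Ventures.CertifiedManyBodySolver.Theorems.M3x2EdgeSplitSymReplayOutRouteEtaSem
import Summits.Ventures.CertifiedManyBodySolver.Theorems.M3x2EdgeSplitSymReplayOutRouteMFD
import HarnessLib

/-!
# SymReplay checker — WORD-LEVEL FACTOR ROWS («η»), part 3a: the ENGINE form «ηD» — word-level rows as DENSE INTEGER vectors,
dot = the native `ddot` of `…OutRouteMFD`; grouping / accumulator / dot identities (the list bridge and the closing are part 3b
`…OutRouteEtaDBridge`)

(team lb-sym, cell hub-lb; hub-lb-sym-eng-3 g4 (η part 2b of ETA-symeng3.md / EBUDGET-600 §11b), on the pen's η spec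
(hub-lb-sym-plan-1 g5, landed as `…OutRouteEta` / `…OutRouteEtaSem`) and on hub-lb-sym-eng-4's integer / dense row levers
`…OutRouteMFZ` / `…OutRouteMFD` (`blockDen`, `blockRowsZ`, `liftOKR`, `rows_eq_lift`, `wflatZ`, `ddot`, `stepOptD`); ADDITIVE, nothing
landed is touched.)

WHY (measured, hub-lb-sym-eng-3 g4 «η BENCH 1+2», real rung-V certificate, interpreted).  The η SPEC form evaluates `drow`
(`n·|ch|·|L|`) and the interpreted `ℚ` merge `sdot` on full-support rows (176 µs per dot at width 130); the pen's `Array` form `drowA`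
re-lists a `ℚ` accumulator and still ends in `sdot`.  A dense `ℚ` dot (`zipWith`/`sum` over `Rat`) costs 109 µs at width 130, the dense
INTEGER dot `ddot` 22 µs.  All representative and generated-basis term coefficients of the certificates of record are INTEGERS (rung V:
max denominator 1 on all 85 blocks), so the word-level rows `ρ_u = Σ c · L_i`, `σ_w = Σ d · L_j` are integer combinations of the
integer rows `L = Lz / D` of `…OutRouteMFZ`: `ρ_u = ρ̃_u / D` with `ρ̃_u := Σ c · Lz_i ∈ ℤⁿ`, and `⟨ρ_u, σ_w⟩ = ddot ρ̃_u σ̃_w / D²`.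

HOW.  Per block (once per module): `n := colBoundR B` (= the spec's `colBound (toGramBlock B)`, computed tail-recursively from the
rows), `D := blockDen B`, `rz := blockRowsZ B`, block constant `kb := −(|moves|·scale)/D²`; tagged terms carry the SPARSE integer rows;
per word group `ch` (the spec's `wgroup`, polymorphic in the row payload) ONE scatter-accumulate `daccZ n ch : Array ℤ` (cost
`Σ_{y∈ch} |Lz_y|`, coefficient read as `c.num`) listed ONCE (`.toList`, hoisted — the pen's `drowA` re-evaluated its accumulator per
column, ×18 on rung V); per word pair the landed `stepOptD` (`g := ddot ρ̃ σ̃`, emit `kb · g · (1 · 1)`).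
SOUNDNESS (this file = the ingredients; part 3b assembles the LIST EQUALITY with the spec share and the closing): (a) the executable
objects `colBoundR`, `scatZ`/`daccZ`, `dheadD`/`dgroupD`, `rowFastFηD`, `shareRWithMFηD`, **`shareRFastMFηD S K gbs hm κ₂ J L i f`** and
the NEW cheap global side fact **`intCoefOK K gbs`** (every representative / generated-basis term coefficient is an integer; one
`native_decide` per certificate, next to `hcov`; NO `denseOKR` is needed — the scatter is column-indexed); (b) grouping commutes with
re-tagging the row payload: `tagRep_map`, `wsort_map` (core `List.map_mergeSort`), `splitBy_map` (induction on `List.splitBy.loop`),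
**`wgroup_map`**; (c) the accumulator holds `Σ c.num · Lz` column-wise (`scatZ_spec`, `daccZ_foldl_spec`, **`daccZ_toList`**); (d) the
lifted dense row `liftD` and **the dot identity `sdot (liftD D n a) (liftD D n b) = ddot a b / D²`** (`sdot_eq_sum` + `ddot_eq_sum`),
**`stepOpt_liftD`** (= `stepOptD`, block constant folded); (e) **the accumulator identity `drow n (lifted group) = liftD D n (daccZ n ch).toList`**
(integer coefficients, `rowCoef_liftRow`), `dgroup_lift_eq` (spec word-level rows of a lifted tagged list = lifts of the dense rows),
`dgroupD_length`.  Part 3b's closing `energyDensity_ge_of_outroutePMFηD0` takes `…PMF0`'s binder list + `hC : intCoefOK K gbs = true`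
ONLY (`liftOKR` and the rows-ascending premise are discharged for every certificate by `…SideFactsWf`'s `liftOKR_all` /
`hAsc_of_wellFormed`, hub-lb-sym-ref-2 g2 / hub-lb-sym-eng-4 g3).  The grouping is the LANDED `wgroup` (`wordLt` comparator), so the
engine share is LIST-EQUAL to the landed spec share; a keyed comparator («ηK», pen's pass 4–6 `le`) is a follow-up lever through core
`List.map_mergeSort` (identical list under an order-isomorphic key), not part of this file.  Standard axioms; no `native_decide` here.

PRICE (by value): dots per module × 0.955 on rung V (2 938 → 2 866 representative word rows, 17 045 → 16 645 basis word rows — no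
gain to show there), × 0.658 at E₁ (census kit j317218, EBUDGET-600 rev 4 §11 rows η+MFD); table build ≈ 4 s per module on rung V.

HONEST FRAMING: an interpreted replay-COST lever with its equality proofs; certifies nothing; no bound of record moves; tree floor
−0.8942613047 (rung V, computational) unchanged; #529 −0.8295699476 outside Lean; `LowerEdge_ge_m83o100` met BY VALUE only; no summit
or crux statement is proved here; nothing here predicts superconductivity.
-/

namespace Summit.Ventures.CertifiedManyBodySolver.Theorems.SymReplay

open Literature.MathematicalPhysics.QuantumLattice
open Literature.MathematicalPhysics.QuantumLattice.HubbardWave0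
open Literature.MathematicalPhysics.QuantumLattice.ThermodynamicLimit
open Literature.Probability.LatticeModels
open Literature.MathematicalPhysics.QuantumManyBody.StateRelaxation
open Summit.Ventures.CertifiedManyBodySolver.Theorems.WardSlot

/-! ##### (a) the dense integer word-level rows and the ηD enumerator (executable) -/

/-- Tail-recursive block width = the spec's `colBound (toGramBlock B)` (`colBoundR_eq`), read off the rows only. -/
def colBoundR (B : GramBlockR) : ℕ := (B.rows.flatMap fun r => r.map Prod.snd).foldl max 0 + 1

/-- Integer scatter-accumulate: add `c · rz` (columns `< n`) into a dense accumulator of width `n`. -/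
def scatZ (n : ℕ) (c : ℤ) (a : Array ℤ) (r : List (ℤ × ℕ)) : Array ℤ :=
  r.foldl (fun a e => if e.2 < n then a.modify e.2 (fun q => q + c * e.1) else a) a

/-- **Dense integer word-level row of a group** `Σ_{(Lz,(c,·)) ∈ ch} c.num · Lz` (width `n`; coefficients are integers under `intCoefOK`). -/
def daccZ (n : ℕ) (ch : List (List (ℤ × ℕ) × (ℚ × Word))) : Array ℤ :=
  ch.foldl (fun a y => scatZ n y.2.1.num a y.1) (Array.replicate n 0)

/-- The dense word-level tagged term of a (nonempty) group: `(ρ̃_u, (1, u))` — the accumulator is listed ONCE here. -/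
def dheadD (n : ℕ) : List (List (ℤ × ℕ) × (ℚ × Word)) → Option (List ℤ × (ℚ × Word))
  | [] => none
  | y :: ys => some ((daccZ n (y :: ys)).toList, ((1 : ℚ), y.2.2))

/-- **Dense integer word-level rows**: one tagged term per word group of `L` (the spec's `wgroup`, integer-row payload). -/
def dgroupD (n : ℕ) (L : List (List (ℤ × ℕ) × (ℚ × Word))) : List (List ℤ × (ℚ × Word)) :=
  (wgroup L).filterMap (dheadD n)

section EtaD

variable {M : Type} [DecidableEq M] [Hashable M]

/-- **One dense word-level representative row** against the bucket map of dense word-level basis rows: per target `mt` the bucket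
of `mt − mom u`, the secondary test on the product word FIRST, then the landed `stepOptD` (one `ddot`, block constant `kb`). -/
def rowFastFηD (S : MomSpec M) (y : List ℤ × (ℚ × Word)) (wmap : Std.HashMap M (List (List ℤ × (ℚ × Word)))) (kb : ℚ)
    (T : List M) (P₂ : Word → Bool) : QPoly :=
  T.flatMap fun mt =>
    (wmap.getD (S.sub mt (mom S y.2.2)) []).filterMap fun x =>
      if P₂ (y.2.2 ++ x.2.2) then stepOptD y.1 kb y.2 x else none

/-- **ENGINE η R-part of sub-module `(i, f)`**: per block the integer rows, `kb = −(m·s)/D²`, ONE bucket map of the dense word-level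
basis rows, one `rowFastFηD` per dense word-level representative row. -/
def shareRWithMFηD (S : MomSpec M) (K : SymCertR) (gbs : List (List QPoly)) (T : List M) (P₂ : Word → Bool) : QPoly :=
  (K.gramR.zip gbs).flatMap fun Bg =>
    let n := colBoundR Bg.1
    let D := blockDen Bg.1
    let rz := blockRowsZ Bg.1
    let kb : ℚ := -1 * ((Bg.1.moves.length : ℚ) * Bg.1.scale) / ((D : ℚ) * D)
    let wmap := bucketBy (fun x : List ℤ × (ℚ × Word) => mom S x.2.2) (dgroupD n (wflatZ (Bg.2.zip rz)))
    (dgroupD n (tagRep (Bg.1.reps.zip rz))).flatMap fun y => rowFastFηD S y wmap kb T P₂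

/-- **ENGINE η sub-module share** — the function a module file evaluates (base and `gramM` parts as `shareRFastMF`). -/
def shareRFastMFηD (S : MomSpec M) (K : SymCertR) (gbs : List (List QPoly)) (hm : MomTable M) (κ₂ : Word → ℕ)
    (J L i f : ℕ) : QPoly :=
  let P := wordPred (inSlotW (momKey S hm) J i)
  let P₂ : Word → Bool := fun w => κ₂ w % L == f
  (baseShareF K.toSymCert P).filter (wordPred P₂) ++
  ((pscale (-1) (K.gramM.flatMap fun B => (gramBlockPoly B).filter P)).filter (wordPred P₂) ++
    shareRWithMFηD S K gbs (targetsM hm J i) P₂)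

/-- Integrality test of a rational. -/
def isIntQ (q : ℚ) : Bool := decide ((q.num : ℚ) = q)

/-- **The one new global side fact**: every representative term and every generated-basis term has an INTEGER coefficient. -/
def intCoefOK (K : SymCertR) (gbs : List (List QPoly)) : Bool :=
  (K.gramR.all fun B => B.reps.all fun p => p.all fun t => isIntQ t.1) &&
    gbs.all fun qs => qs.all fun p => p.all fun t => isIntQ t.1

/-! ##### (b) grouping commutes with re-tagging the row payload -/

omit [DecidableEq M] [Hashable M] in
/-- `tagRep` after mapping the rows = mapping the row payload of `tagRep`. -/
theorem tagRep_map {ρ ρ' : Type} (g : ρ → ρ') : ∀ (ra : List (QPoly × ρ)),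
    tagRep (ra.map fun a => (a.1, g a.2)) = (tagRep ra).map fun y => (g y.1, y.2)
  | [] => rfl
  | a :: ra => by
    have ih := tagRep_map g ra
    simp only [tagRep, List.map_cons, List.flatMap_cons, List.map_append, List.map_map] at ih ⊢
    rw [ih]
    rfl

omit [DecidableEq M] [Hashable M] in
/-- Sorting by word commutes with mapping the row payload (core `List.map_mergeSort`; the comparator reads words only). -/
theorem wsort_map {ρ ρ' : Type} (g : ρ → ρ') (L : List (ρ × (ℚ × Word))) :
    wsort (L.map fun y => (g y.1, y.2)) = (wsort L).map fun y => (g y.1, y.2) := by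
  rw [wsort, wsort, List.map_mergeSort]
  intro a _ b _
  rfl

omit [DecidableEq M] [Hashable M] in
/-- `List.splitBy.loop` commutes with `map` when the relation is read through the map. -/
theorem splitBy_loop_map {α β : Type} (R : β → β → Bool) (R' : α → α → Bool) (φ : α → β)
    (h : ∀ a b, R (φ a) (φ b) = R' a b) : ∀ (as : List α) (ag : α) (g : List α) (gs : List (List α)),
    List.splitBy.loop R (as.map φ) (φ ag) (g.map φ) (gs.map (List.map φ)) =
      (List.splitBy.loop R' as ag g gs).map (List.map φ)
  | [], ag, g, gs => by
    simp [List.splitBy.loop, List.map_reverse]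
  | a :: as, ag, g, gs => by
    have ih₁ := splitBy_loop_map R R' φ h as a (ag :: g) gs
    have ih₂ := splitBy_loop_map R R' φ h as a [] (((ag :: g).reverse) :: gs)
    simp only [List.map_cons, List.map_nil, List.map_reverse] at ih₁ ih₂
    rw [List.map_cons, List.splitBy.loop, List.splitBy.loop, h]
    cases R' ag a
    · simpa [List.map_reverse] using ih₂
    · simpa using ih₁

omit [DecidableEq M] [Hashable M] in
/-- `List.splitBy` commutes with `map` when the relation is read through the map. -/
theorem splitBy_map {α β : Type} (R : β → β → Bool) (R' : α → α → Bool) (φ : α → β)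
    (h : ∀ a b, R (φ a) (φ b) = R' a b) : ∀ (l : List α), (l.map φ).splitBy R = (l.splitBy R').map (List.map φ)
  | [] => rfl
  | a :: as => by
    have h0 := splitBy_loop_map R R' φ h as a [] []
    simp only [List.map_nil] at h0
    exact h0

omit [DecidableEq M] [Hashable M] in
/-- **Grouping commutes with mapping the row payload** (sort and split read words only). -/
theorem wgroup_map {ρ ρ' : Type} (g : ρ → ρ') (L : List (ρ × (ℚ × Word))) :
    wgroup (L.map fun y => (g y.1, y.2)) = (wgroup L).map (List.map fun y => (g y.1, y.2)) := by
  rw [wgroup, wgroup, wsort_map]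
  exact splitBy_map _ _ _ (fun _ _ => rfl) _

/-! ##### (c) the accumulator: `daccZ` holds `Σ c.num · Lz` column-wise -/

/-- Integer column coefficient of a sparse integer row. -/
def rowCoefZ (rz : List (ℤ × ℕ)) (k : ℕ) : ℤ := (rz.map fun e => if e.2 = k then e.1 else 0).sum

/-- Column `k` of the integer word-level row of a group. -/
def accZ (ch : List (List (ℤ × ℕ) × (ℚ × Word))) (k : ℕ) : ℤ := (ch.map fun y => y.2.1.num * rowCoefZ y.1 k).sum

omit [DecidableEq M] [Hashable M] in
/-- `rowCoefZ` of a cons. -/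
theorem rowCoefZ_cons (e : ℤ × ℕ) (r : List (ℤ × ℕ)) (k : ℕ) :
    rowCoefZ (e :: r) k = (if e.2 = k then e.1 else 0) + rowCoefZ r k := by
  rw [rowCoefZ, rowCoefZ, List.map_cons, List.sum_cons]

omit [DecidableEq M] [Hashable M] in
/-- `accZ` of a cons. -/
theorem accZ_cons (y : List (ℤ × ℕ) × (ℚ × Word)) (ch : List (List (ℤ × ℕ) × (ℚ × Word))) (k : ℕ) :
    accZ (y :: ch) k = y.2.1.num * rowCoefZ y.1 k + accZ ch k := by
  rw [accZ, accZ, List.map_cons, List.sum_cons]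

omit [DecidableEq M] [Hashable M] in
/-- The integer scatter step adds `c · rowCoefZ r` column-wise (pattern of the pen's `scat_spec`). -/
theorem scatZ_spec (n : ℕ) (c : ℤ) : ∀ (r : List (ℤ × ℕ)) (a : Array ℤ) (f : ℕ → ℤ),
    (∀ k, a[k]? = if k < n then some (f k) else none) →
      ∀ k, (scatZ n c a r)[k]? = if k < n then some (f k + c * rowCoefZ r k) else none
  | [], a, f, ha => fun k => by rw [scatZ, List.foldl_nil, ha k]; simp [rowCoefZ]
  | e :: r, a, f, ha => by
    intro k
    rw [scatZ, List.foldl_cons, ← scatZ, rowCoefZ_cons, mul_add, ← add_assoc]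
    refine scatZ_spec n c r _ (fun k => f k + c * (if e.2 = k then e.1 else 0)) ?_ k
    intro k'
    by_cases hlt : e.2 < n
    · rw [if_pos hlt, Array.getElem?_modify, ha k']
      by_cases he : e.2 = k'
      · subst he
        rw [if_pos rfl, if_pos hlt, if_pos hlt, if_pos rfl, Option.map_some]
      · rw [if_neg he, if_neg he, mul_zero, add_zero]
    · rw [if_neg hlt, ha k']
      by_cases hk : k' < n
      · rw [if_pos hk, if_pos hk, if_neg (by rintro rfl; exact hlt hk), mul_zero, add_zero]
      · rw [if_neg hk, if_neg hk]

omit [DecidableEq M] [Hashable M] in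
/-- The accumulator fold holds the integer word-level row column-wise. -/
theorem daccZ_foldl_spec (n : ℕ) : ∀ (ch : List (List (ℤ × ℕ) × (ℚ × Word))) (a : Array ℤ) (f : ℕ → ℤ),
    (∀ k, a[k]? = if k < n then some (f k) else none) →
      ∀ k, (ch.foldl (fun a y => scatZ n y.2.1.num a y.1) a)[k]? = if k < n then some (f k + accZ ch k) else none
  | [], a, f, ha => fun k => by rw [List.foldl_nil, ha k, accZ, List.map_nil, List.sum_nil, add_zero]
  | y :: ch, a, f, ha => fun k => by
    rw [List.foldl_cons, daccZ_foldl_spec n ch _ _ (scatZ_spec n y.2.1.num y.1 a f ha) k, accZ_cons, add_assoc]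

omit [DecidableEq M] [Hashable M] in
/-- **The listed accumulator IS the column function** `accZ ch` on `range n`. -/
theorem daccZ_toList (n : ℕ) (ch : List (List (ℤ × ℕ) × (ℚ × Word))) :
    (daccZ n ch).toList = (List.range n).map (accZ ch) := by
  apply List.ext_getElem?
  intro k
  have h := daccZ_foldl_spec n ch (Array.replicate n 0) (fun _ => 0) (fun k => by rw [Array.getElem?_replicate]) k
  simp only [zero_add] at h
  by_cases hk : k < n
  · rw [if_pos hk] at h
    rw [Array.getElem?_toList, daccZ, h, List.getElem?_map, List.getElem?_range hk, Option.map_some]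
  · rw [if_neg hk] at h
    rw [Array.getElem?_toList, daccZ, h, List.getElem?_map, List.getElem?_eq_none (by simp; omega), Option.map_none]

/-! ##### (d) the lifted dense row `liftD` and the dot identity -/

/-- The `ℚ` row of record a dense integer word-level row stands for: full support on `range n`, entries `a_k / D`. -/
def liftD (D : ℚ) (n : ℕ) (a : List ℤ) : List (ℚ × ℕ) := (List.range n).map fun k => (((a.getD k 0 : ℤ) : ℚ) / D, k)

omit [DecidableEq M] [Hashable M] in
/-- `liftD` rows are ascending. -/
theorem rowAsc_liftD (D : ℚ) (n : ℕ) (a : List ℤ) : rowAsc (liftD D n a) = true := by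
  rw [liftD, List.range_eq_range']; exact rowAsc_map_range' _ n 0

omit [DecidableEq M] [Hashable M] in
/-- `liftD` columns are `< n`. -/
theorem liftD_bound (D : ℚ) (n : ℕ) (a : List ℤ) : ∀ e ∈ liftD D n a, e.2 < n := by
  intro e he
  rw [liftD, List.mem_map] at he
  obtain ⟨k, hk, rfl⟩ := he
  exact List.mem_range.1 hk

omit [DecidableEq M] [Hashable M] in
/-- The coefficient of `liftD` at column `k < n`. -/
theorem rowCoef_liftD (D : ℚ) (n : ℕ) (a : List ℤ) {k : ℕ} (hk : k < n) :
    rowCoef (liftD D n a) k = ((a.getD k 0 : ℤ) : ℚ) / D := by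
  rw [rowCoef, liftD, List.map_map, ← List.sum_toFinset _ List.nodup_range, List.toFinset_range]
  simp only [Function.comp_def]
  rw [Finset.sum_ite_eq' (Finset.range n) k, if_pos (Finset.mem_range.2 hk)]

omit [DecidableEq M] [Hashable M] in
/-- **The dense dot as a column sum** (lists of length `n`). -/
theorem ddot_eq_sum : ∀ (n : ℕ) (u v : List ℤ), u.length = n → v.length = n →
    ddot u v = ∑ k ∈ Finset.range n, u.getD k 0 * v.getD k 0
  | 0, [], [], _, _ => by simp
  | n + 1, a :: u, b :: v, hu, hv => by
    rw [ddot_cons, Finset.sum_range_succ', ddot_eq_sum n u v (by simpa using hu) (by simpa using hv), add_comm]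
    simp
  | 0, _ :: _, _, hu, _ => by simp at hu
  | 0, [], _ :: _, _, hv => by simp at hv
  | _ + 1, [], _, hu, _ => by simp at hu
  | _ + 1, _ :: _, [], _, hv => by simp at hv

omit [DecidableEq M] [Hashable M] in
/-- **THE DOT IDENTITY**: the `ℚ` dot of record of two lifted dense rows is the integer `ddot` over `D²`. -/
theorem sdot_liftD (D : ℚ) (n : ℕ) (a b : List ℤ) (ha : a.length = n) (hb : b.length = n) :
    sdot (liftD D n a) (liftD D n b) = ((ddot a b : ℤ) : ℚ) / (D * D) := by
  rw [sdot_eq_sum n _ _ (rowAsc_liftD D n a) (rowAsc_liftD D n b) (liftD_bound D n a) (liftD_bound D n b),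
    Fin.sum_univ_eq_sum_range (fun k => rowCoef (liftD D n a) k * rowCoef (liftD D n b) k) n, ddot_eq_sum n a b ha hb,
    Int.cast_sum, Finset.sum_div]
  refine Finset.sum_congr rfl fun k hk => ?_
  rw [rowCoef_liftD D n a (Finset.mem_range.1 hk), rowCoef_liftD D n b (Finset.mem_range.1 hk), Int.cast_mul]
  ring

omit [DecidableEq M] [Hashable M] in
/-- **`stepOpt` on lifted dense rows IS `stepOptD`** (block constant folded; coefficient identity by `ring`). -/
theorem stepOpt_liftD (D : ℚ) (hD : D ≠ 0) (n : ℕ) (a : List ℤ) (ha : a.length = n) (m s : ℚ) (t : ℚ × Word)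
    (x : List ℤ × (ℚ × Word)) (hx : x.1.length = n) :
    stepOpt ([], liftD D n a) m s t (liftD D n x.1, x.2) = stepOptD a (-1 * (m * s) / (D * D)) t x := by
  obtain ⟨b, cw⟩ := x
  unfold stepOpt stepOptD
  simp only [sdot_liftD D n a b ha hx]
  have hDD : D * D ≠ 0 := mul_ne_zero hD hD
  by_cases hg : ddot a b = 0
  · simp [hg]
  · have hq : ((ddot a b : ℤ) : ℚ) / (D * D) ≠ 0 := div_ne_zero (by exact_mod_cast hg) hDD
    rw [if_neg hq, if_neg hg]
    congr 1
    refine Prod.ext ?_ rfl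
    show -1 * (m * (s * (((ddot a b : ℤ) : ℚ) / (D * D)))) * (t.1 * cw.1) = -1 * (m * s) / (D * D) * ((ddot a b : ℤ) : ℚ) * (t.1 * cw.1)
    ring

/-! ##### (e) the accumulator identity: the spec's `drow` of a lifted group IS `liftD` of `daccZ` (integer coefficients) -/

omit [DecidableEq M] [Hashable M] in
/-- `rowCoef` of a lifted integer row. -/
theorem rowCoef_liftRow (D : ℚ) (rz : List (ℤ × ℕ)) (k : ℕ) : rowCoef (liftRow D rz) k = ((rowCoefZ rz k : ℤ) : ℚ) / D := by
  induction rz with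
  | nil => simp [rowCoef, rowCoefZ, liftRow]
  | cons e rz ih =>
    obtain ⟨z, i⟩ := e
    have ih' : rowCoef (liftRow D rz) k = ((rowCoefZ rz k : ℤ) : ℚ) / D := ih
    rw [rowCoefZ_cons, show liftRow D ((z, i) :: rz) = (((z : ℚ) / D, i)) :: liftRow D rz from rfl, rowCoef_cons, ih',
      Int.cast_add, add_div]
    by_cases he : i = k
    · rw [if_pos he, if_pos he]
    · rw [if_neg he, if_neg he, Int.cast_zero, zero_div]

omit [DecidableEq M] [Hashable M] in
/-- Column `k` of the spec's word-level row of a LIFTED group with integer coefficients = `accZ / D`. -/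
theorem accZ_cast (D : ℚ) (k : ℕ) : ∀ (ch : List (List (ℤ × ℕ) × (ℚ × Word))),
    (∀ y ∈ ch, ((y.2.1.num : ℤ) : ℚ) = y.2.1) →
      (ch.map fun y => y.2.1 * rowCoef (liftRow D y.1) k).sum = ((accZ ch k : ℤ) : ℚ) / D
  | [], _ => by simp [accZ]
  | y :: ch, hI => by
    rw [List.map_cons, List.sum_cons, accZ_cast D k ch (fun y' hy' => hI y' (List.mem_cons_of_mem _ hy')), rowCoef_liftRow,
      accZ_cons, Int.cast_add, Int.cast_mul, hI y List.mem_cons_self, add_div, mul_div_assoc]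

omit [DecidableEq M] [Hashable M] in
/-- **Accumulator identity**: for a group with integer coefficients, the spec's word-level row of the LIFTED group is the lift of
the integer accumulator. -/
theorem drow_lift_eq_liftD (D : ℚ) (n : ℕ) (ch : List (List (ℤ × ℕ) × (ℚ × Word)))
    (hI : ∀ y ∈ ch, ((y.2.1.num : ℤ) : ℚ) = y.2.1) :
    drow n (ch.map fun y => (liftRow D y.1, y.2)) = liftD D n (daccZ n ch).toList := by
  rw [drow, liftD, daccZ_toList]
  refine List.map_congr_left fun k hk => ?_
  have hk' := List.mem_range.1 hk
  rw [List.map_map, List.getD_eq_getElem?_getD, List.getElem?_map, List.getElem?_range hk', Option.map_some,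
    Option.getD_some]
  exact Prod.ext (accZ_cast D k ch hI) rfl

/-- The spec's word-level tagged term a dense one stands for (proof device; never evaluated). -/
def liftT (D : ℚ) (n : ℕ) (yD : List ℤ × (ℚ × Word)) : List (ℚ × ℕ) × (ℚ × Word) := (liftD D n yD.1, yD.2)

omit [DecidableEq M] [Hashable M] in
/-- **Spec word-level rows of a lifted tagged list = lifts of the dense integer word-level rows** (integer coefficients). -/
theorem dgroup_lift_eq (D : ℚ) (n : ℕ) (LZ : List (List (ℤ × ℕ) × (ℚ × Word)))
    (hI : ∀ y ∈ LZ, ((y.2.1.num : ℤ) : ℚ) = y.2.1) :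
    dgroup n (LZ.map fun y => (liftRow D y.1, y.2)) = (dgroupD n LZ).map (liftT D n) := by
  rw [dgroup, dgroupD, wgroup_map, List.filterMap_map, List.map_filterMap]
  refine List.filterMap_congr fun ch hch => ?_
  have hIch : ∀ y ∈ ch, ((y.2.1.num : ℤ) : ℚ) = y.2.1 := fun y hy => hI y (mem_of_mem_wgroup hch hy)
  cases ch with
  | nil => rfl
  | cons y ys =>
    show some (drow n ((y :: ys).map fun y => (liftRow D y.1, y.2)), ((1 : ℚ), y.2.2)) =
      some (liftD D n (daccZ n (y :: ys)).toList, ((1 : ℚ), y.2.2))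
    rw [drow_lift_eq_liftD D n _ hIch]

omit [DecidableEq M] [Hashable M] in
/-- Dense word-level rows have length `n`. -/
theorem dgroupD_length {n : ℕ} {L : List (List (ℤ × ℕ) × (ℚ × Word))} {yD : List ℤ × (ℚ × Word)}
    (h : yD ∈ dgroupD n L) : yD.1.length = n := by
  rw [dgroupD, List.mem_filterMap] at h
  obtain ⟨ch, -, hy⟩ := h
  cases ch with
  | nil => exact absurd hy (by simp [dheadD])
  | cons y ys =>
    simp only [dheadD, Option.some.injEq] at hy
    rw [← hy, daccZ_toList, List.length_map, List.length_range]

end EtaD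

end Summit.Ventures.CertifiedManyBodySolver.Theorems.SymReplay
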